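import Summits.KontsevichZagierPeriods.KontsevichZagierPeriods.Theorems.LinRedNormalFormArrangementNormalFormStubRebaseOneAbove

/-!
# Stub `stub_rebaseOne` (crux `ArrangementNormalForm`, line `janus-bands`) — the stub

`stub_rebaseOne` (skeleton v4 of crux `ArrangementNormalForm`, line `janus-bands`): a separated
Janus band representation with ONE base coordinate `y` and ONE fibre `t` (class `GG 0 1 1`: base
factor `q (y−ℓ₁)^{n₁}/(y−ℓ₂)^{n₂}`, one optional letter `1/(t − c(y))` affine in `y`, affine bounds)
is congruent modulo `KZ.relations` to a `ℤ`-combination of REBASED ones (class `GG 0 2 1`: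
constant letter, bounds constant or exactly `y`). Read the literal datum as a band representation;
a letter-free band is one shear-and-rescale (rule 2); a lettered band is dissected (rule 1a, null
walls) by the signs of `u − c` and `v − c` on the base and by the letter line into bands with a
bound ON the letter (terminal) and bands strictly above / below the letter (reflection `t ↦ −t`,
then part `Above`: terminal, thick Janus split, blow-up at a pinch on the letter line, or Janus
split at the apex level).

References: M. Kontsevich, D. Zagier, *Periods* (2001), §1.2.
-/

noncomputable section

open Set MeasureTheory
open Literature.NumberTheory.Transcendental
open Literature.ModelTheory.ExponentialFields

namespace Summit.KontsevichZagierPeriods.ArrangementNormalForm.JanusBands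

namespace RebaseOne

/-! ### The lettered case -/

/-- Adding the (redundant) row `v − u > 0`. -/
theorem IsBandRep.addRow {r : KZ.IntegralRep 2} {m : ℕ} {M : Fin m → Aff} {U V : Aff} {T : IData}
    {a : Option Aff} (h : IsBandRep r M U V T a) :
    IsBandRep r (Fin.cons (V - U) M : Fin (m + 1) → Aff) U V T a := by
  refine ⟨?_, h.int, h.bdd, h.adm⟩
  rw [h.dom]
  ext z
  simp only [band, mem_setOf_eq, mem_baseSet_cons, ev_sub, sub_pos]
  constructor
  · rintro ⟨hb, h1, h2⟩; exact ⟨⟨by linarith, hb⟩, h1, h2⟩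
  · rintro ⟨⟨-, hb⟩, h1, h2⟩; exact ⟨hb, h1, h2⟩

/-- A lettered band with `c < u` on the base is good (part `Above`). -/
theorem good_cU {r : KZ.IntegralRep 2} {m : ℕ} {M : Fin m → Aff} {U V : Aff} {T : IData}
    {c : Aff} (h : IsBandRep r M U V T (some c)) (hI : ∀ y ∈ baseSet M, ev c y < ev U y) :
    Good (KZ.of r) :=
  good_above h.addRow fun y hy => by
    rw [mem_baseSet_cons, ev_sub, sub_pos] at hy
    exact ⟨hI y hy.2, hy.1⟩

/-- A lettered band with `v < c` on the base is good: reflect `t ↦ −t`. -/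
theorem good_Vc {r : KZ.IntegralRep 2} {m : ℕ} {M : Fin m → Aff} {U V : Aff} {T : IData}
    {c : Aff} (h : IsBandRep r M U V T (some c)) (hI : ∀ y ∈ baseSet M, ev V y < ev c y) :
    Good (KZ.of r) := by
  obtain ⟨r', h', hrel⟩ := band_reflect h
  exact good_of_sub_mem hrel (good_cU h' fun y hy => by simpa using hI y hy)

/-- A lettered band crossed by its letter (`u < c < v` on the base) is good: cut along the letter
line (rule 1a); both halves have a bound on the letter. -/
theorem good_UcV {r : KZ.IntegralRep 2} {m : ℕ} {M : Fin m → Aff} {U V : Aff} {T : IData}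
    {c : Aff} (h : IsBandRep r M U V T (some c))
    (hI : ∀ y ∈ baseSet M, ev U y < ev c y ∧ ev c y < ev V y) : Good (KZ.of r) := by
  refine good_split2 h M M U c c V ?_ ?_ ?_ (volume_graph_ev c) ?_
    (fun r' hr' => good_upperPar hr' rfl) (fun r' hr' => good_lowerPar hr' rfl)
  · rw [h.dom]
    rintro z ⟨hy, h1, h2⟩
    exact ⟨hy, h1, by linarith [(hI _ hy).2]⟩
  · rw [h.dom]
    rintro z ⟨hy, h1, h2⟩
    exact ⟨hy, by linarith [(hI _ hy).1], h2⟩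
  · exact Set.disjoint_left.2 fun z hz hz' => by linarith [hz.2.2, hz'.2.1]
  · intro z hz hzN
    rw [h.dom] at hz
    obtain ⟨hy, h1, h2⟩ := hz
    rcases lt_trichotomy (z 1) (ev c (z 0)) with ht | ht | ht
    · exact Or.inl ⟨hy, h1, ht⟩
    · exact absurd ht hzN
    · exact Or.inr ⟨hy, ht, h2⟩

/-- **Cutting the base by the sign of a nonzero atom** (rule 1a, null vertical wall). -/
theorem good_rowSplit {r : KZ.IntegralRep 2} {m : ℕ} {M : Fin m → Aff} {U V : Aff} {T : IData}
    {a : Option Aff} (h : IsBandRep r M U V T a) (q : Aff) (hq : q ≠ 0)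
    (hg₁ : ∀ r' : KZ.IntegralRep 2, IsBandRep r' (Fin.cons q M : Fin (m + 1) → Aff) U V T a →
      Good (KZ.of r'))
    (hg₂ : ∀ r' : KZ.IntegralRep 2, IsBandRep r' (Fin.cons (-q) M : Fin (m + 1) → Aff) U V T a →
      Good (KZ.of r')) : Good (KZ.of r) := by
  refine good_split2 h (Fin.cons q M) (Fin.cons (-q) M) U V U V ?_ ?_ ?_ (volume_ev_eq_zero q hq)
    ?_ hg₁ hg₂
  · rw [h.dom]
    rintro z ⟨hy, h1, h2⟩
    exact ⟨((mem_baseSet_cons _ _ _).1 hy).2, h1, h2⟩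
  · rw [h.dom]
    rintro z ⟨hy, h1, h2⟩
    exact ⟨((mem_baseSet_cons _ _ _).1 hy).2, h1, h2⟩
  · refine Set.disjoint_left.2 fun z hz hz' => ?_
    have h1 := ((mem_baseSet_cons _ _ _).1 hz.1).1
    have h2 := ((mem_baseSet_cons _ _ _).1 hz'.1).1
    rw [ev_neg] at h2
    linarith
  · intro z hz hzN
    rw [h.dom] at hz
    obtain ⟨hy, h1, h2⟩ := hz
    rcases lt_trichotomy (ev q (z 0)) 0 with ht | ht | ht
    · exact Or.inr ⟨(mem_baseSet_cons _ _ _).2 ⟨by rw [ev_neg]; linarith, hy⟩, h1, h2⟩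
    · exact absurd ht hzN
    · exact Or.inl ⟨(mem_baseSet_cons _ _ _).2 ⟨ht, hy⟩, h1, h2⟩

/-- **A lettered band representation is good.** -/
theorem good_lettered {r : KZ.IntegralRep 2} {m : ℕ} {M : Fin m → Aff} {U V : Aff} {T : IData}
    {c : Aff} (h : IsBandRep r M U V T (some c)) : Good (KZ.of r) := by
  by_cases hUc : U = c
  · exact good_lowerPar h (by rw [hUc])
  by_cases hVc : V = c
  · exact good_upperPar h (by rw [hVc])
  refine good_rowSplit h (U - c) (sub_ne_zero.2 hUc) (fun r₁ h₁ => ?_) (fun r₁ h₁ => ?_)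
  · exact good_cU h₁ fun y hy => by
      have := ((mem_baseSet_cons _ _ _).1 hy).1
      rw [ev_sub] at this
      linarith
  · have hU : ∀ y ∈ baseSet (Fin.cons (-(U - c)) M : Fin (m + 1) → Aff), ev U y < ev c y :=
      fun y hy => by
        have := ((mem_baseSet_cons _ _ _).1 hy).1
        rw [ev_neg, ev_sub] at this
        linarith
    refine good_rowSplit h₁ (V - c) (sub_ne_zero.2 hVc) (fun r₂ h₂ => ?_) (fun r₂ h₂ => ?_)
    · exact good_UcV h₂ fun y hy => by
        obtain ⟨h1, h2⟩ := (mem_baseSet_cons _ _ _).1 hy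
        rw [ev_sub] at h1
        exact ⟨hU y h2, by linarith⟩
    · exact good_Vc h₂ fun y hy => by
        have := ((mem_baseSet_cons _ _ _).1 hy).1
        rw [ev_neg, ev_sub] at this
        linarith

/-- **Every band representation is good.** -/
theorem good_band {r : KZ.IntegralRep 2} {m : ℕ} {M : Fin m → Aff} {U V : Aff} {T : IData}
    {a : Option Aff} (h : IsBandRep r M U V T a) : Good (KZ.of r) := by
  cases a with
  | none => exact good_noLetter h
  | some c => exact good_lettered h

/-! ### Reading the literal datum -/

/-- The base factor of the literal text with `n₁ = 0 ∨ n₂ = 0` has a single centre. -/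
theorem pow_div_pow_eq (ℓ₁ ℓ₂ : ℚ) {n₁ n₂ : ℕ} (h12 : n₁ = 0 ∨ n₂ = 0) (y : ℝ) :
    (y - ℓ₁) ^ n₁ / (y - ℓ₂) ^ n₂ =
      (y - ((if n₁ = 0 then ℓ₂ else ℓ₁ : ℚ) : ℝ)) ^ n₁ / (y - ((if n₁ = 0 then ℓ₂ else ℓ₁ : ℚ) : ℝ)) ^ n₂ := by
  rcases h12 with rfl | rfl
  · simp
  · by_cases h1 : n₁ = 0
    · simp [h1]
    · simp [h1]

/-- **The main lemma on the literal text.** A representation with the literal `GG 0 1 1` datum is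
good. -/
theorem main_good {m m' n₁ n₂ : ℕ} (s : KZ.IntegralRep (0 + 1 + 1)) (M : Fin m' → (Fin (0 + 1) → ℚ) × ℚ) (L : Fin m → (Fin 0 → ℚ) × ℚ) (e : Fin m → ℕ) (p : MvPolynomial (Fin 0) ℚ) (ℓ₁ ℓ₂ : (Fin 0 → ℚ) × ℚ) (a : Fin 1 → Option ((Fin (0 + 1) → ℚ) × ℚ)) (lo hi : Fin 1 → Fin 1 ⊕ ((Fin (0 + 1) → ℚ) × ℚ)) (h12 : n₁ = 0 ∨ n₂ = 0) (hbd : Bornology.IsBounded s.domain) (hdom : s.domain = {z | (∀ j, 0 < ∑ i, ((M j).1 i : ℝ) * z (Fin.castAdd 1 i) + ((M j).2 : ℝ)) ∧ ∀ i, Sum.elim (fun j => z (Fin.natAdd (0 + 1) j)) (fun c => ∑ i', (c.1 i' : ℝ) * z (Fin.castAdd 1 i') + (c.2 : ℝ)) (lo i) < z (Fin.natAdd (0 + 1) i) ∧ z (Fin.natAdd (0 + 1) i) < Sum.elim (fun j => z (Fin.natAdd (0 + 1) j)) (fun c => ∑ i', (c.1 i' : ℝ) * z (Fin.castAdd 1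 i') + (c.2 : ℝ)) (hi i)}) (hint : EqOn s.integrand (fun z => MvPolynomial.aeval (fun i => z (Fin.castAdd 1 (Fin.castSucc i))) p / (∏ j, (∑ i, ((L j).1 i : ℝ) * z (Fin.castAdd 1 (Fin.castSucc i)) + ((L j).2 : ℝ)) ^ e j) * ((z (Fin.castAdd 1 (Fin.last 0)) - (∑ i, (ℓ₁.1 i : ℝ) * z (Fin.castAdd 1 (Fin.castSucc i)) + (ℓ₁.2 : ℝ))) ^ n₁ / (z (Fin.castAdd 1 (Fin.last 0)) - (∑ i, (ℓ₂.1 i : ℝ) * z (Fin.castAdd 1 (Fin.castSucc i)) + (ℓ₂.2 : ℝ))) ^ n₂) * ∏ i, (a i).elim 1 (fun c => 1 / (z (Fin.natAdd (0 + 1) i) - (∑ i', (c.1 i' : ℝ) * z (Fin.castAdd 1 i') + (c.2 : ℝ))))) s.domain) :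
    Good (KZ.of s) := by
  -- degenerate bounds: empty domain
  have hnat : ∀ j : Fin 1, Fin.natAdd (0 + 1) j = (1 : Fin 2) := fun j => by
    rw [Subsingleton.elim j 0]; rfl
  have empty_good : s.domain = ∅ → Good (KZ.of s) := fun he =>
    good_of_mem_relations (KZ.of_mem_relations_of_volume_eq_zero s (by rw [he, measure_empty]))
  rcases hlo : lo 0 with j | cu
  · refine empty_good (Set.eq_empty_iff_forall_notMem.2 fun z hz => ?_)
    rw [hdom] at hz
    have := (hz.2 0).1
    rw [hlo, Sum.elim_inl, hnat, hnat] at this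
    exact lt_irrefl _ this
  rcases hhi : hi 0 with j | cv
  · refine empty_good (Set.eq_empty_iff_forall_notMem.2 fun z hz => ?_)
    rw [hdom] at hz
    have := (hz.2 0).2
    rw [hhi, Sum.elim_inl, hnat, hnat] at this
    exact lt_irrefl _ this
  -- the dictionary
  set Mq : Fin m' → Aff := fun j => ((M j).1 0, (M j).2) with hMq
  set Cq : ℚ := p.coeff 0 / ∏ j, (L j).2 ^ e j with hCq
  set μ : ℚ := if n₁ = 0 then ℓ₂.2 else ℓ₁.2 with hμ
  set aq : Option Aff := (a 0).map (fun c => (c.1 0, c.2)) with haq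
  have hrep : IsBandRep (s : KZ.IntegralRep 2) Mq (cu.1 0, cu.2) (cv.1 0, cv.2) (Cq, μ, n₁, n₂) aq := by
    refine ⟨?_, fun z hz => ?_, hbd, h12⟩
    · rw [hdom]
      ext z
      simp only [band, baseSet, mem_setOf_eq, Fin.sum_univ_succ, Finset.univ_eq_empty,
        Finset.sum_empty, add_zero, castAdd_zero, Fin.forall_fin_one, hlo, hhi, Sum.elim_inr,
        natAdd_zero, ev, hMq]
    · rw [hint hz, MvPolynomial.eq_C_of_isEmpty p]
      have hprod : ∀ i : Fin 1, (a i).elim (1 : ℝ) (fun c => 1 / (z (Fin.natAdd (0 + 1) i) -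
          (∑ i', (c.1 i' : ℝ) * z (Fin.castAdd 1 i') + (c.2 : ℝ)))) =
          aq.elim 1 (fun c => 1 / (z 1 - ev c (z 0))) := by
        refine Fin.forall_fin_one.2 ?_
        rw [haq]
        cases a 0 with
        | none => rfl
        | some c =>
          simp only [Option.elim_some, Option.map_some, natAdd_zero, Fin.sum_univ_succ,
            Finset.univ_eq_empty, Finset.sum_empty, add_zero, castAdd_zero, ev]
      simp only [MvPolynomial.aeval_C, eq_ratCast, Finset.univ_eq_empty, Finset.sum_empty, zero_add,
        castAdd_last, Fin.prod_univ_one, hprod, integ, gfun, pow_div_pow_eq ℓ₁.2 ℓ₂.2 h12, hCq, ← hμ]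
      push_cast
      ring
  exact good_band hrep

end RebaseOne

open RebaseOne in
/-- **stub_rebaseOne** (the card's `JanusOneLetter` template). One base coordinate `y`, one fibre
`t` with letter `γy + δ` and affine bounds `a(y) < t < b(y)`: read as a band representation,
dissect along the letter line and the sign walls of `a − c`, `b − c` (rule 1a), reflect bands below
the letter (rule 2); a band above its letter is normalised by a shear-and-rescale (a bound parallel
to the letter), a thick Janus split, a blow-up (pinch on the letter line) or a Janus split at the
apex level (both pieces pinch there and stay absolutely convergent); a letter-free band is one
shear-and-rescale. Every output has constant letter and bounds constant or `y`: `GG 0 2 1`. -/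
theorem stub_rebaseOne (GG : ℕ → ℕ → ℕ → Set KZ.FormalRep) (hGG : ∀ b σ k, GG b σ k = {w : KZ.FormalRep | ∃ (m m' n₁ n₂ : ℕ) (s : KZ.IntegralRep (b + 1 + k)) (M : Fin m' → (Fin (b + 1) → ℚ) × ℚ) (L : Fin m → (Fin b → ℚ) × ℚ) (e : Fin m → ℕ) (p : MvPolynomial (Fin b) ℚ) (ℓ₁ ℓ₂ : (Fin b → ℚ) × ℚ) (a : Fin k → Option ((Fin (b + 1) → ℚ) × ℚ)) (lo hi : Fin k → Fin k ⊕ ((Fin (b + 1) → ℚ) × ℚ)), (n₁ = 0 ∨ n₂ = 0) ∧ (σ = 2 → (∀ i c, a i = some c → c.1 (Fin.last b) = 0) ∧ (∀ i c, (lo i = Sum.inr c ∨ hi i = Sum.inr c) → (c.1 (Fin.last b) = 0 ∨ c = (Pi.single (Fin.last b) 1, 0)))) ∧ Bornology.IsBounded s.domain ∧ s.domain = {z | (∀ j, 0 < ∑ i, ((M j).1 i : ℝ) * z (Fin.castAdd k i) + ((M j).2 : ℝ)) ∧ ∀ i, Sum.elim (fun j => z (Fin.natAdd (b + 1) j)) (fun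 c => ∑ i', (c.1 i' : ℝ) * z (Fin.castAdd k i') + (c.2 : ℝ)) (lo i) < z (Fin.natAdd (b + 1) i) ∧ z (Fin.natAdd (b + 1) i) < Sum.elim (fun j => z (Fin.natAdd (b + 1) j)) (fun c => ∑ i', (c.1 i' : ℝ) * z (Fin.castAdd k i') + (c.2 : ℝ)) (hi i)} ∧ EqOn s.integrand (fun z => MvPolynomial.aeval (fun i => z (Fin.castAdd k (Fin.castSucc i))) p / (∏ j, (∑ i, ((L j).1 i : ℝ) * z (Fin.castAdd k (Fin.castSucc i)) + ((L j).2 : ℝ)) ^ e j) * ((z (Fin.castAdd k (Fin.last b)) - (∑ i, (ℓ₁.1 i : ℝ) * z (Fin.castAdd k (Fin.castSucc i)) + (ℓ₁.2 : ℝ))) ^ n₁ / (z (Fin.castAdd k (Fin.last b)) - (∑ i, (ℓ₂.1 i : ℝ) * z (Fin.castAdd k (Fin.castSucc i)) + (ℓ₂.2 : ℝ))) ^ n₂) * ∏ i, (a i).elim 1 (fun c => 1 / (z (Fin.natAdd (b + 1) i) - (∑ i', (c.1 i' : ℝ) * z (Fin.castAdd k i') + (c.2 : ℝ))))) s.domain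 ∧ w = KZ.of s}) : ∀ x ∈ GG 0 1 1, ∃ c ∈ AddSubgroup.closure (GG 0 2 1), x - c ∈ KZ.relations := by
  intro x hx
  have h021 : GG 0 2 1 = GGlit 0 2 1 := hGG 0 2 1
  rw [hGG] at hx
  obtain ⟨m, m', n₁, n₂, s, M, L, e, p, ℓ₁, ℓ₂, a, lo, hi, h12, -, hbd, hdom, hint, rfl⟩ := hx
  rw [h021]
  exact main_good s M L e p ℓ₁ ℓ₂ a lo hi h12 hbd hdom hint

end Summit.KontsevichZagierPeriods.ArrangementNormalForm.JanusBands
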